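import Literature.NumberTheory.EllipticCurves.StevensSmoothingModEightProofs
import Summits.BirchSwinnertonDyer.BirchSwinnertonDyer.Theorems.EisensteinDepletionAtTwoStarGlueFinPointwise
import HarnessLib

/-!
# Route `EisensteinDepletionAtTwo`, crux E1M `DepletedLambdaLawAtTwoMod` (item stmt-BirchSwinnertonDyer-20341),
# line `star`, skeleton v3 — (★-EisEight), part 1: the Stevens smoothing of the SCALE-1 cusp-difference function is
# `≡ 0 (mod 8)` pointwise on the `η = +1` classes of every level `≥ 3` (hypothesis (ii) of lit's mod-8 rigidity)

Cell `bsd-rank2`, seat `bsd-rank2-eng-2` GEN 8. THEOREMS ONLY — no definition, no named fact, no `sorry`. HONEST FRAMING: pure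
`2`-adic arithmetic of Dedekind–Rademacher sums (no elliptic curve); closes the registered stub `stub_starEisEight` of
`Cruxes/…/Lines/star.lean` v3 once RETYPED to lit GEN 21's corrected form (19:30Z: the `ℤ`-form `v = 8n` is false since
`v ∈ ℤ[1/rad N]`, e.g. `v(3,5) = 48/7` at `N = 21`; the `2`-adic form below is what the glue consumes). Nothing here reads an
analytic rank; (★-SymbC)/(★)/E1M are NOT proved; BSD is not proved by any of this (PARTITION D-0054: none — r_an ≥ 2 axis S0,
door T-r3₂). ROAD (lit GEN 21 18:58Z/19:30Z): apply the mod-`8` rigidity theorem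
`Literature.NumberTheory.EllipticCurves.norm_le_eighth_of_stevensSmoothing` (p558349) to the `α = 1` cusp-difference function
`f(a + 2^Lℤ₂) = v(L, A) − v(L−1, A mod 2^{L−1})` on the `η = +1` classes of the levels `L ≥ 3`: (i) `‖f‖ ≤ 1`
(`norm_stabEisCuspDiff_le_one`); (ii) `‖Sm_5^5 f‖ ≤ 8⁻¹` — `Sm f = −12·Sm E + c_β·(integer) − 16·(2-adic integer)` pointwise
(`…StarSmoothedMeasure` §D at scale `1`, levels `≥ 3`) and `‖Sm E‖ ≤ ½` (lit `norm_smoothedEisensteinDedekindTwo_le_half`);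
(iii) the tower relation holds `mod 8` up to a level constant: the Dedekind part `E` is an exact distribution
(`eisensteinDedekindTwo_distribution`), and the Bézout boundary part has tower defect `c_β·(½ + ℤ) ⊂ 8ℤ₂`
(`N·y_{X,k} ≡ X⁻¹ (mod 2^k)` only; `‖c_β‖₂ ≤ 2⁻⁴`); (iv) `f(1) = 0`. Then `‖f‖ ≤ 8⁻¹` from level `3` on, and
`v(L, a) = f + v(L−1, ā)` telescopes down to `v(2, 1) = 0`.

* `exists_int_smoothed_boundary_three` (levels `≥ 3`), **`norm_stevensSmoothing_cuspDiff_le_eighth`** ((ii)).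
  The tower relation (iii), the rigidity application and `starEisEight₂` are the sequel file `…StarEisEight.lean`.

References: G. Stevens, *Arithmetic on Modular Curves* (1982), §5.2, §5.4 [Stevens1982]; B. Mazur, J. Tate, J. Teitelbaum,
Invent. Math. 84 (1986), §I.10–I.11 [MazurTateTeitelbaum1986Invent]; H. Rademacher, E. Grosswald, *Dedekind Sums* (1972), Ch. 4 A
[RademacherGrosswald1972].
-/

set_option linter.dupNamespace false
set_option autoImplicit false

noncomputable section

open scoped Classical

open Filter Topology Literature.NumberTheory.EllipticCurves Literature.NumberTheory.ModularForms
  Summit.BirchSwinnertonDyer.Rank1Residual.X1.MuLambda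

namespace Summit.BirchSwinnertonDyer.BirchSwinnertonDyer.Theorems.DepletionAtTwo

section EisEightSmoothing

variable {N : ℕ} {β : ℕ → ℕ}

/-- **The smoothed boundary term is an integer** (levels `m ≥ 3`; same proof as `exists_int_smoothed_boundary`): for `m ≥ 3`, `a.val ≡ 1 (4)`, with
`B(X) = N·(y_{X,m}/2^m − y_{X̄,m−1}/2^{m−1})`, the combination `B(A) − 5B(A·5⁻¹) − 5B(A·5) + 25B(A)` lies in `ℤ`
(`N y_X − 5 N y_{5X} ≡ X⁻¹ − X⁻¹ ≡ 0 (mod 2^m)`, any Bézout representatives). [folklore] -/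
theorem exists_int_smoothed_boundary_three (hodd : Odd N) {m : ℕ} (hm : 3 ≤ m) (a : ZMod (2 ^ m)) (ha : a.val % 4 = 1) :
    ∃ z : ℤ, (fun X : ℕ ↦ (N : ℚ) * ((Int.gcdB ((2 ^ m : ℕ) : ℤ) (X * N) : ℚ) / (2 ^ m : ℕ) -
        (Int.gcdB ((2 ^ (m - 1) : ℕ) : ℤ) (((X % 2 ^ (m - 1) : ℕ) : ℤ) * N) : ℚ) / (2 ^ (m - 1) : ℕ))) a.val -
      5 * (fun X : ℕ ↦ (N : ℚ) * ((Int.gcdB ((2 ^ m : ℕ) : ℤ) (X * N) : ℚ) / (2 ^ m : ℕ) -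
        (Int.gcdB ((2 ^ (m - 1) : ℕ) : ℤ) (((X % 2 ^ (m - 1) : ℕ) : ℤ) * N) : ℚ) / (2 ^ (m - 1) : ℕ)))
          (a * ((5 : ℕ) : ZMod (2 ^ m))⁻¹).val -
      5 * (fun X : ℕ ↦ (N : ℚ) * ((Int.gcdB ((2 ^ m : ℕ) : ℤ) (X * N) : ℚ) / (2 ^ m : ℕ) -
        (Int.gcdB ((2 ^ (m - 1) : ℕ) : ℤ) (((X % 2 ^ (m - 1) : ℕ) : ℤ) * N) : ℚ) / (2 ^ (m - 1) : ℕ)))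
          (a * ((5 : ℕ) : ZMod (2 ^ m))).val +
      25 * (fun X : ℕ ↦ (N : ℚ) * ((Int.gcdB ((2 ^ m : ℕ) : ℤ) (X * N) : ℚ) / (2 ^ m : ℕ) -
        (Int.gcdB ((2 ^ (m - 1) : ℕ) : ℤ) (((X % 2 ^ (m - 1) : ℕ) : ℤ) * N) : ℚ) / (2 ^ (m - 1) : ℕ))) a.val = z := by
  simp only []
  -- names
  set A := a.val with hA
  set Ap := (a * ((5 : ℕ) : ZMod (2 ^ m))).val with hAp
  set Am := (a * ((5 : ℕ) : ZMod (2 ^ m))⁻¹).val with hAm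
  obtain ⟨hp4, hm4⟩ := val_shift_mod_four (by omega : 3 ≤ m) a ha
  have hAo : Odd (A : ℤ) := by exact_mod_cast odd_val_of_mod_four a ha
  have hApo : Odd (Ap : ℤ) := by exact_mod_cast odd_val_of_mod_four _ hp4
  have hAmo : Odd (Am : ℤ) := by exact_mod_cast odd_val_of_mod_four _ hm4
  have hbar : ∀ {X : ℕ}, Odd (X : ℤ) → Odd (((X % 2 ^ (m - 1) : ℕ) : ℤ)) := fun {X} hX ↦ by
    have hX' : Odd X := by exact_mod_cast hX
    exact_mod_cast odd_mod_two_pow hX' (by omega)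
  -- the shift congruences at level `m`
  have hc1 : ((2 ^ m : ℕ) : ℤ) ∣ (Ap : ℤ) - 5 * A := dvd_val_mul_five (by omega) a
  have hc2 : ((2 ^ m : ℕ) : ℤ) ∣ (A : ℤ) - 5 * Am := dvd_val_mul_five_inv (by omega) a
  -- and at level `m − 1`
  have hdvd' : ((2 ^ (m - 1) : ℕ) : ℤ) ∣ ((2 ^ m : ℕ) : ℤ) := by
    exact_mod_cast (pow_dvd_pow 2 (by omega : m - 1 ≤ m))
  have hmod : ∀ X : ℕ, ((2 ^ (m - 1) : ℕ) : ℤ) ∣ (X : ℤ) - ((X % 2 ^ (m - 1) : ℕ) : ℤ) := fun X ↦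
    (Nat.mod_modEq X (2 ^ (m - 1))).dvd
  have hc1' : ((2 ^ (m - 1) : ℕ) : ℤ) ∣ ((Ap % 2 ^ (m - 1) : ℕ) : ℤ) - 5 * ((A % 2 ^ (m - 1) : ℕ) : ℤ) := by
    have h := (hdvd'.trans hc1)
    have e : ((Ap % 2 ^ (m - 1) : ℕ) : ℤ) - 5 * ((A % 2 ^ (m - 1) : ℕ) : ℤ) =
        ((Ap : ℤ) - 5 * A) - ((Ap : ℤ) - ((Ap % 2 ^ (m - 1) : ℕ) : ℤ)) + 5 * ((A : ℤ) - ((A % 2 ^ (m - 1) : ℕ) : ℤ)) := by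
      ring
    rw [e]
    exact dvd_add (dvd_sub h (hmod Ap)) (dvd_mul_of_dvd_right (hmod A) _)
  have hc2' : ((2 ^ (m - 1) : ℕ) : ℤ) ∣ ((A % 2 ^ (m - 1) : ℕ) : ℤ) - 5 * ((Am % 2 ^ (m - 1) : ℕ) : ℤ) := by
    have h := (hdvd'.trans hc2)
    have e : ((A % 2 ^ (m - 1) : ℕ) : ℤ) - 5 * ((Am % 2 ^ (m - 1) : ℕ) : ℤ) =
        ((A : ℤ) - 5 * Am) - ((A : ℤ) - ((A % 2 ^ (m - 1) : ℕ) : ℤ)) + 5 * ((Am : ℤ) - ((Am % 2 ^ (m - 1) : ℕ) : ℤ)) := by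
      ring
    rw [e]
    exact dvd_add (dvd_sub h (hmod A)) (dvd_mul_of_dvd_right (hmod Am) _)
  -- the four divisibilities
  obtain ⟨q₁, hq₁⟩ := two_pow_dvd_bezout_shift hodd m hAo hApo 5 hc1
  obtain ⟨q₂, hq₂⟩ := two_pow_dvd_bezout_shift hodd (m - 1) (hbar hAo) (hbar hApo) 5 hc1'
  obtain ⟨q₃, hq₃⟩ := two_pow_dvd_bezout_shift hodd m hAmo hAo 5 hc2
  obtain ⟨q₄, hq₄⟩ := two_pow_dvd_bezout_shift hodd (m - 1) (hbar hAmo) (hbar hAo) 5 hc2'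
  refine ⟨q₁ - q₂ - 5 * (q₃ - q₄), ?_⟩
  have h2m : ((2 ^ m : ℕ) : ℚ) ≠ 0 := by positivity
  have h2m' : ((2 ^ (m - 1) : ℕ) : ℚ) ≠ 0 := by positivity
  have hq₁' : (N : ℚ) * ((Int.gcdB ((2 ^ m : ℕ) : ℤ) (A * N) : ℚ) - 5 * (Int.gcdB ((2 ^ m : ℕ) : ℤ) (Ap * N) : ℚ)) =
      ((2 ^ m : ℕ) : ℚ) * q₁ := by exact_mod_cast hq₁
  have hq₂' : (N : ℚ) * ((Int.gcdB ((2 ^ (m - 1) : ℕ) : ℤ) (((A % 2 ^ (m - 1) : ℕ) : ℤ) * N) : ℚ) -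
      5 * (Int.gcdB ((2 ^ (m - 1) : ℕ) : ℤ) (((Ap % 2 ^ (m - 1) : ℕ) : ℤ) * N) : ℚ)) = ((2 ^ (m - 1) : ℕ) : ℚ) * q₂ := by
    exact_mod_cast hq₂
  have hq₃' : (N : ℚ) * ((Int.gcdB ((2 ^ m : ℕ) : ℤ) (Am * N) : ℚ) - 5 * (Int.gcdB ((2 ^ m : ℕ) : ℤ) (A * N) : ℚ)) =
      ((2 ^ m : ℕ) : ℚ) * q₃ := by exact_mod_cast hq₃
  have hq₄' : (N : ℚ) * ((Int.gcdB ((2 ^ (m - 1) : ℕ) : ℤ) (((Am % 2 ^ (m - 1) : ℕ) : ℤ) * N) : ℚ) -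
      5 * (Int.gcdB ((2 ^ (m - 1) : ℕ) : ℤ) (((A % 2 ^ (m - 1) : ℕ) : ℤ) * N) : ℚ)) = ((2 ^ (m - 1) : ℕ) : ℚ) * q₄ := by
    exact_mod_cast hq₄
  -- abbreviate the Bézout coefficients (as rationals)
  set D : ℚ := ((2 ^ m : ℕ) : ℚ) with hD
  set D' : ℚ := ((2 ^ (m - 1) : ℕ) : ℚ) with hD'
  set yA : ℚ := (Int.gcdB ((2 ^ m : ℕ) : ℤ) (A * N) : ℚ)
  set yAp : ℚ := (Int.gcdB ((2 ^ m : ℕ) : ℤ) (Ap * N) : ℚ)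
  set yAm : ℚ := (Int.gcdB ((2 ^ m : ℕ) : ℤ) (Am * N) : ℚ)
  set zA : ℚ := (Int.gcdB ((2 ^ (m - 1) : ℕ) : ℤ) (((A % 2 ^ (m - 1) : ℕ) : ℤ) * N) : ℚ)
  set zAp : ℚ := (Int.gcdB ((2 ^ (m - 1) : ℕ) : ℤ) (((Ap % 2 ^ (m - 1) : ℕ) : ℤ) * N) : ℚ)
  set zAm : ℚ := (Int.gcdB ((2 ^ (m - 1) : ℕ) : ℤ) (((Am % 2 ^ (m - 1) : ℕ) : ℤ) * N) : ℚ)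
  have e1 : (N : ℚ) * (yA / D - zA / D') - 5 * ((N : ℚ) * (yAp / D - zAp / D')) = (q₁ : ℚ) - q₂ := by
    rw [show (N : ℚ) * (yA / D - zA / D') - 5 * ((N : ℚ) * (yAp / D - zAp / D')) =
      ((N : ℚ) * (yA - 5 * yAp)) / D - ((N : ℚ) * (zA - 5 * zAp)) / D' by ring, hq₁', hq₂',
      mul_div_cancel_left₀ _ h2m, mul_div_cancel_left₀ _ h2m']
  have e2 : (N : ℚ) * (yAm / D - zAm / D') - 5 * ((N : ℚ) * (yA / D - zA / D')) = (q₃ : ℚ) - q₄ := by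
    rw [show (N : ℚ) * (yAm / D - zAm / D') - 5 * ((N : ℚ) * (yA / D - zA / D')) =
      ((N : ℚ) * (yAm - 5 * yA)) / D - ((N : ℚ) * (zAm - 5 * zA)) / D' by ring, hq₃', hq₄',
      mul_div_cancel_left₀ _ h2m, mul_div_cancel_left₀ _ h2m']
  rw [show ((q₁ - q₂ - 5 * (q₃ - q₄) : ℤ) : ℚ) = (q₁ : ℚ) - q₂ - 5 * ((q₃ : ℚ) - q₄) by push_cast; ring]
  linear_combination e1 - 5 * e2


/-- **(ii) at scale `1`, levels `≥ 3`: `‖Sm_5^5 f(a)‖₂ ≤ 8⁻¹`** for the `α = 1` cusp-difference function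
`f(a + 2^Lℤ₂) = v(L, A) − v(L−1, Ā)` on the `η = +1` classes (`0` elsewhere and below level `3`).
Mechanism: `Sm f = −12·Sm E + c_β·z − 16·K` with `z ∈ ℤ`, `‖K‖ ≤ 1`, `‖c_β‖ ≤ 2⁻⁴`, `‖Sm E‖ ≤ ½`.
[cite: Stevens1982, §5.4 Prop. 5.4.1 (PDF p. 73)] -/
theorem norm_stevensSmoothing_cuspDiff_le_eighth (hodd : Odd N) (hadm : IsAdmissibleStabData N β) {L : ℕ}
    (hL : 3 ≤ L) (a : ZMod (2 ^ L)) (ha : a.val % 4 = 1) :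
    ‖stevensSmoothing 5 (fun (n : ℕ) (b : ZMod (2 ^ n)) ↦ if 3 ≤ n ∧ b.val % 4 = 1 then
        (((stabEisCuspDiff N β n (b.val : ℤ) - stabEisCuspDiff N β (n - 1) ((b.val % 2 ^ (n - 1) : ℕ) : ℤ) : ℚ)) : ℚ_[2])
        else 0) L a‖ ≤ 8⁻¹ := by
  have hN : N ≠ 0 := fun h ↦ by simp [h] at hodd
  obtain ⟨hp4, hm4⟩ := val_shift_mod_four hL a ha
  obtain ⟨z, hz⟩ := exists_int_smoothed_boundary_three hodd hL a ha
  simp only [] at hz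
  set f : (n : ℕ) → ZMod (2 ^ n) → ℚ_[2] := fun n b ↦ if 3 ≤ n ∧ b.val % 4 = 1 then
    (((stabEisCuspDiff N β n (b.val : ℤ) - stabEisCuspDiff N β (n - 1) ((b.val % 2 ^ (n - 1) : ℕ) : ℤ) : ℚ)) : ℚ_[2])
    else 0 with hf
  set cβ : ℚ := ∑ t ∈ N.divisors, stabCoeff N β t / t with hcβ
  set E : ℕ → ℚ := fun X ↦ ∑ t ∈ N.divisors, stabCoeff N β t *
    (dedekindSum (t * X : ℤ) (2 ^ L) - dedekindSum (t * X : ℤ) (2 ^ (L - 1))) with hE_def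
  set B : ℕ → ℚ := fun X ↦ (N : ℚ) * ((Int.gcdB ((2 ^ L : ℕ) : ℤ) (X * N) : ℚ) / (2 ^ L : ℕ) -
    (Int.gcdB ((2 ^ (L - 1) : ℕ) : ℤ) (((X % 2 ^ (L - 1) : ℕ) : ℤ) * N) : ℚ) / (2 ^ (L - 1) : ℕ)) with hB_def
  set Φ : ℕ → ℚ := fun X ↦
    stabEisensteinPeriod N β (gammaEntries N X ((2 ^ L : ℕ) : ℤ)).1 (gammaEntries N X ((2 ^ L : ℕ) : ℤ)).2.1
        (gammaEntries N X ((2 ^ L : ℕ) : ℤ)).2.2.1 (gammaEntries N X ((2 ^ L : ℕ) : ℤ)).2.2.2 -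
      stabEisensteinPeriod N β (gammaEntries N ((X % 2 ^ (L - 1) : ℕ) : ℤ) ((2 ^ (L - 1) : ℕ) : ℤ)).1
        (gammaEntries N ((X % 2 ^ (L - 1) : ℕ) : ℤ) ((2 ^ (L - 1) : ℕ) : ℤ)).2.1
        (gammaEntries N ((X % 2 ^ (L - 1) : ℕ) : ℤ) ((2 ^ (L - 1) : ℕ) : ℤ)).2.2.1
        (gammaEntries N ((X % 2 ^ (L - 1) : ℕ) : ℤ) ((2 ^ (L - 1) : ℕ) : ℤ)).2.2.2 with hΦ_def
  have hz' : B a.val - 5 * B (a * ((5 : ℕ) : ZMod (2 ^ L))⁻¹).val - 5 * B (a * ((5 : ℕ) : ZMod (2 ^ L))).val +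
      25 * B a.val = z := hz
  have hΦ : ∀ X : ℕ, Odd X → Φ X = -12 * E X + cβ * B X := fun X hX ↦ by
    simp only [hΦ_def, hE_def, hB_def, hcβ]
    exact stabEisensteinPeriod_sub_level hodd hadm (by omega) hX
  -- values of `f` on the `η = +1` classes of level `L`
  have h1 : (1 : ℕ) % 2 ^ (L - 1) = 1 := Nat.one_mod_eq_one.mpr (by
    have : 2 ≤ 2 ^ (L - 1) := by
      calc (2 : ℕ) = 2 ^ 1 := by norm_num
        _ ≤ 2 ^ (L - 1) := Nat.pow_le_pow_right (by norm_num) (by omega)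
    omega)
  have hfx : ∀ x : ZMod (2 ^ L), x.val % 4 = 1 → f L x = (((Φ x.val - Φ 1) : ℚ) : ℚ_[2]) := fun x hx ↦ by
    simp only [hf, if_pos (show 3 ≤ L ∧ x.val % 4 = 1 from ⟨hL, hx⟩), hΦ_def, h1, Nat.cast_one]
    unfold stabEisCuspDiff
    push_cast
    ring
  have hE : ∀ x : ZMod (2 ^ L), x.val % 4 = 1 →
      eisensteinDedekindTwo N.divisors (stabCoeff N β) L x = ((E x.val : ℚ) : ℚ_[2]) := fun x hx ↦ by
    rw [eisensteinDedekindTwo_apply_of_mod_four hodd (by omega) x hx]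
  have hsm : smoothedEisensteinDedekindTwo N.divisors (stabCoeff N β) L a =
      eisensteinDedekindTwo N.divisors (stabCoeff N β) L a -
        5 * eisensteinDedekindTwo N.divisors (stabCoeff N β) L (a * ((5 : ℕ) : ZMod (2 ^ L))⁻¹) -
        5 * eisensteinDedekindTwo N.divisors (stabCoeff N β) L (a * ((5 : ℕ) : ZMod (2 ^ L))) +
        25 * eisensteinDedekindTwo N.divisors (stabCoeff N β) L a := by
    rw [← stevensSmoothing_eisensteinDedekindTwo]
    exact stevensSmoothing_five_apply _ L a
  have hA : Odd a.val := odd_val_of_mod_four a ha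
  have hAp : Odd (a * ((5 : ℕ) : ZMod (2 ^ L))).val := odd_val_of_mod_four _ hp4
  have hAm : Odd (a * ((5 : ℕ) : ZMod (2 ^ L))⁻¹).val := odd_val_of_mod_four _ hm4
  have hq : ((Φ a.val - Φ 1) - 5 * (Φ (a * ((5 : ℕ) : ZMod (2 ^ L))⁻¹).val - Φ 1) -
        5 * (Φ (a * ((5 : ℕ) : ZMod (2 ^ L))).val - Φ 1) + 25 * (Φ a.val - Φ 1)) +
      12 * (E a.val - 5 * E (a * ((5 : ℕ) : ZMod (2 ^ L))⁻¹).val - 5 * E (a * ((5 : ℕ) : ZMod (2 ^ L))).val +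
        25 * E a.val) = cβ * z - 16 * Φ 1 := by
    rw [hΦ _ hA, hΦ _ hAp, hΦ _ hAm, ← hz']
    ring
  have hcast : stevensSmoothing 5 f L a + 12 * smoothedEisensteinDedekindTwo N.divisors (stabCoeff N β) L a =
      ((cβ * z - 16 * Φ 1 : ℚ) : ℚ_[2]) := by
    rw [← hq, stevensSmoothing_five_apply, hfx a ha, hfx _ hm4, hfx _ hp4, hsm, hE a ha, hE _ hm4, hE _ hp4]
    push_cast
    ring
  -- sizes
  have hcβn : ‖((cβ : ℚ) : ℚ_[2])‖ ≤ (2 : ℝ) ^ (-(4 : ℤ)) := norm_cBeta_le hN hodd hadm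
  have hΦ1 : ‖((Φ 1 : ℚ) : ℚ_[2])‖ ≤ 1 := by
    simp only [hΦ_def, h1, Nat.cast_one, Rat.cast_sub]
    rw [sub_eq_add_neg]
    refine (Padic.nonarchimedean _ _).trans (max_le ?_ ?_)
    · exact_mod_cast norm_stabEisensteinPeriod_gammaEntries_le_one hodd β L odd_one
    · rw [norm_neg]
      exact_mod_cast norm_stabEisensteinPeriod_gammaEntries_le_one hodd β (L - 1) odd_one
  have hκ : ∀ t ∈ N.divisors, ‖((stabCoeff N β t : ℚ) : ℚ_[2])‖ ≤ 1 := fun t _ ↦ norm_stabCoeff_le_one hodd t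
  have hsmE : ‖smoothedEisensteinDedekindTwo N.divisors (stabCoeff N β) L a‖ ≤ 2⁻¹ :=
    norm_smoothedEisensteinDedekindTwo_le_half N.divisors (stabCoeff N β) hκ (by omega) a
  have h16 : ‖(16 : ℚ_[2])‖ = (2 : ℝ) ^ (-(4 : ℤ)) := by
    rw [show (16 : ℚ_[2]) = ((2 : ℕ) : ℚ_[2]) ^ 4 by norm_num, Padic.norm_p_pow]; norm_num
  have h12 : ‖(12 : ℚ_[2])‖ ≤ 4⁻¹ := by
    rw [show (12 : ℚ_[2]) = ((2 : ℕ) : ℚ_[2]) ^ 2 * ((3 : ℤ) : ℚ_[2]) by norm_num, norm_mul, Padic.norm_p_pow]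
    calc ((2 : ℕ) : ℝ) ^ (-(2 : ℕ) : ℤ) * ‖((3 : ℤ) : ℚ_[2])‖ ≤ ((2 : ℕ) : ℝ) ^ (-(2 : ℕ) : ℤ) * 1 := by
          gcongr; exact Padic.norm_int_le_one 3
      _ = 4⁻¹ := by norm_num
  have hrest : ‖((cβ * z - 16 * Φ 1 : ℚ) : ℚ_[2])‖ ≤ 8⁻¹ := by
    push_cast
    rw [sub_eq_add_neg]
    refine (Padic.nonarchimedean _ _).trans (max_le ?_ ?_)
    · rw [norm_mul]
      calc ‖((cβ : ℚ) : ℚ_[2])‖ * ‖(z : ℚ_[2])‖ ≤ (2 : ℝ) ^ (-(4 : ℤ)) * 1 := by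
            gcongr; exact Padic.norm_int_le_one z
        _ ≤ 8⁻¹ := by norm_num
    · rw [norm_neg, norm_mul, h16]
      calc (2 : ℝ) ^ (-(4 : ℤ)) * ‖((Φ 1 : ℚ) : ℚ_[2])‖ ≤ (2 : ℝ) ^ (-(4 : ℤ)) * 1 := by gcongr
        _ ≤ 8⁻¹ := by norm_num
  have hid : stevensSmoothing 5 f L a = (stevensSmoothing 5 f L a +
      12 * smoothedEisensteinDedekindTwo N.divisors (stabCoeff N β) L a) +
      -(12 * smoothedEisensteinDedekindTwo N.divisors (stabCoeff N β) L a) := by ring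
  rw [hid]
  refine (Padic.nonarchimedean _ _).trans (max_le (by rw [hcast]; exact hrest) ?_)
  rw [norm_neg, norm_mul]
  calc ‖(12 : ℚ_[2])‖ * ‖smoothedEisensteinDedekindTwo N.divisors (stabCoeff N β) L a‖ ≤ 4⁻¹ * 2⁻¹ :=
        mul_le_mul h12 hsmE (norm_nonneg _) (by norm_num)
    _ = 8⁻¹ := by norm_num

end EisEightSmoothing

end Summit.BirchSwinnertonDyer.BirchSwinnertonDyer.Theorems.DepletionAtTwo

end
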